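import Summits.HodgeConjecture.HodgeConjecture.Theorems.MarkmanPartnerTransportPicardThreeK3SquaresQuotientSimilitude
import Literature.AlgebraicGeometry.HodgeTheory.CorrespondenceActionOfGraph
import Literature.AlgebraicGeometry.HodgeTheory.ComplexOrientationDegreeFibre
import Literature.AlgebraicGeometry.HodgeTheory.CurveCorrespondencePushforward
import Literature.AlgebraicGeometry.HodgeTheory.CanonicalTraceCycleClass
import Literature.AlgebraicGeometry.HodgeTheory.AlgebraicClassesPullbackHolds
import Literature.AlgebraicGeometry.HodgeTheory.MaxRationalSubHodgeStructureGysinImages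
import Literature.AlgebraicGeometry.HodgeTheory.HodgeTypeExteriorProduct
import Literature.AlgebraicGeometry.Surfaces.GeometricGenusOneAssociatedK3Surface

/-!
# Route MarkmanPartnerTransport · crux `PicardThreeK3Squares` (stmt-HodgeConjecture-19652) —
# programme «ISOGENY DATUM», brick 1: the transcendental calculus of a morphism of COHOMOLOGICAL
# DEGREE `d` between smooth projective surfaces

Planner task T-P1AT-21 (cell hodge-nonav, memo ROUTE-P1AT §15.2: «a dominant rational map of degree `d`
between projective K3 surfaces is a datum of multiplier `d`») asks for the Varesco DATUM of
`QuotientSimilitude.cycleInduced_of_algebraicSimilitude` from a rational map. A rational map is a ROOF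
`Y ←π— Z —f→ X` of morphisms from a smooth projective surface `Z`; this file is the calculus of ONE leg
`f : Z ⟶ X` of cohomological degree `d`, i.e. with `f₊ 1 = d • 1` for the Gysin morphism of the complex
orientations (for instance `d = #f⁻¹(b)` for a finite fibre of local-homeomorphism points, Fulton's
Lemma 19.1.2 — the tree's `complexGysin_complexOrientationFamily_one_of_finite_fibre`; here
`gysin_one_eq_of_finite_fibre`). For smooth projective surfaces `Z`, `X` over `ℂ`:

* `gysin_map_eq_smul` — **`f₊ f^* y = d • y`** on `Hᵏ(X(ℂ); ℂ)` (projection formula);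
  `map_injective_of_deg` — `f^*` is injective when `d ≠ 0`.
* `traceC_map_eq` — **`∫_Z f^* w = d · ∫_X w`** on `H⁴`; `traceC_cup_map_map` —
  `∫_Z (f^*a ∪ f^*b) = d · ∫_X (a ∪ b)`.
* `traceC_cup_gysin`, `traceC_gysin_cup` — `∫_X (α ∪ f₊ w) = ∫_Z (f^*α ∪ w)` (both orders).
* `map_mem_transcendentalSubspace`, `gysin_mem_transcendentalSubspace` — **`f^* T(X) ⊆ T(Z)` and
  `f₊ T(Z) ⊆ T(X)`** for the transcendental subspaces `T = NS^⊥` (no degree hypothesis: pull-backs and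
  Gysin maps preserve `N¹`, and the trace transposes `f₊` into `f^*`).
* `gysin_surjOn_transcendentalSubspace` — `f₊` maps `T(Z)` ONTO `T(X)` (`z = d⁻¹ f₊ f^* z`).
* `traceC_cup_gysin_gysin_of_le` — **multiplier**: if `T(Z) ⊆ f^* T(X)` (the irreducibility input,
  brick 2 of the programme) then `∫_X (f₊ w ∪ f₊ w') = d · ∫_Z (w ∪ w')` on `T(Z)`.
* `corr_gysinLift_one` — **two-factor push–pull** (Fulton §16.1): for `π : Z ⟶ Y`, `f : Z ⟶ X` the
  algebraic class `γ = (f, π)₊ 1 ∈ H⁴((X ⊗ Y)(ℂ); ℂ)` acts by `pr₁₊(pr₂^* y ∪ γ) = f₊ (π^* y)`;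
  `gysinLift_one_mem_algebraicClasses` — `γ ∈ algebraicClasses (X ⊗ Y) 2`.
* `isRationalClass_gysin_map`, `isOfHodgeType_gysin_map` — `f₊ π^*` is rational and type-preserving.

No definition, no sorry, no named fact beyond the tree's theorems (`fulton1998_map_mem_algebraicClasses_holds'`
is a THEOREM). Prover seat hodge-nonav-19652-p1 (gen 21), `--supports stmt-HodgeConjecture-19652`.
Nothing here proves an instance of the Hodge conjecture.

References: W. Fulton, *Intersection Theory* (2nd ed. 1998), §16.1 Prop. 16.1.1, Def. 16.1.2, Lemma
19.1.2; W. Fulton, *Young Tableaux* (1997), App. B §B.1 (5)–(6); H. Inose, *Defining equations of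
singular K3 surfaces and a notion of isogeny*, Proc. Int. Symp. Algebraic Geometry Kyoto 1977
(Kinokuniya 1978) 495–502, §2; D. R. Morrison, Tokyo J. Math. 10 (1987) §1 (cohomological isogenies).
-/

set_option linter.dupNamespace false

noncomputable section

namespace Summit.HodgeConjecture.HodgeConjecture.Theorems.MarkmanPartnerTransport.FiniteMorphism

open scoped Manifold
open Module CategoryTheory MonoidalCategory CartesianMonoidalCategory
open Literature.AlgebraicGeometry Literature.AlgebraicGeometry.Motives Literature.AlgebraicGeometry.HodgeTheory
open Literature.AlgebraicGeometry.Surfaces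
open Literature.AlgebraicTopology.SingularHomology

variable {Z X Y : SchemeOver ℂ}

/-- `Deg[hZ, hX, f, d]`: `f : Z ⟶ X` has COHOMOLOGICAL DEGREE `d`, i.e. `f₊ 1 = d • 1 ∈ H⁰(X(ℂ); ℂ)` for
the Gysin morphism of the complex orientation family. Local notation only. -/
local notation3 (prettyPrint := false) "Deg[" hZ ", " hX ", " f ", " d "]" =>
  complexGysin complexOrientationFamily hZ hX f (rfl : 0 + 2 * 2 = 0 + 2 * 2)
      (singularCohomology.one ℂ (Motives.ComplexPoints _)) =
    (d : ℂ) • singularCohomology.one ℂ (Motives.ComplexPoints _)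

/-- `Corr[X, Y, hX, hY ; γ, y] = pr₁₊ (pr₂^* y ∪ γ)`: VERBATIM the action of a class
`γ ∈ H⁴((X ⊗ Y)(ℂ); ℂ)` on `y ∈ H²(Y(ℂ); ℂ)` as in `QuotientSimilitude.cycleInduced_of_algebraicSimilitude`
(complex orientations). Local notation only. -/
local notation3 (prettyPrint := false) "Corr[" X ", " Y ", " hX ", " hY " ; " γ ", " y "]" =>
  complexGysin complexOrientationFamily (IsSmoothProjective.tensor_holds hX hY) hX
    (SemiCartesianMonoidalCategory.fst X Y)
    (rfl : 2 * 1 + 2 * 2 + 2 * 2 = 2 * 1 + 2 * (2 + 2))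
    (cupProduct (rfl : 2 * 1 + 2 * 2 = 2 * 1 + 2 * 2)
      (complexBetti.map (SemiCartesianMonoidalCategory.snd X Y) (2 * 1) y) γ)

/-! ### §0 Cohomological degree from a finite fibre -/

/-- **Fulton's degree formula supplies the cohomological degree**: if `b ∈ X(ℂ)` has a finite fibre
`f⁻¹(b) = {v i}` of points at which `f(ℂ)` is a local homeomorphism, then `f₊ 1 = (#ι) • 1`
(the tree's `complexGysin_complexOrientationFamily_one_of_finite_fibre`, restated in the local currency).
[cite: Fulton1998, Lemma 19.1.2] -/
theorem gysin_one_eq_of_finite_fibre (hZ : IsSmoothProjective 2 Z) (hX : IsSmoothProjective 2 X)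
    (f : Z ⟶ X) {ι : Type} [Fintype ι] {v : ι → Motives.ComplexPoints Z} (hv : Function.Injective v)
    {b : Motives.ComplexPoints X} (hfibre : (Motives.AlgPoints.map f) ⁻¹' {b} = Set.range v)
    (hloc : ∀ i, ∃ e : OpenPartialHomeomorph (Motives.ComplexPoints Z) (Motives.ComplexPoints X),
      v i ∈ e.source ∧ (e : Motives.ComplexPoints Z → Motives.ComplexPoints X) = Motives.AlgPoints.map f) :
    Deg[hZ, hX, f, Fintype.card ι] :=
  complexGysin_complexOrientationFamily_one_of_finite_fibre hZ hX f hv hfibre hloc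

/-! ### §1 `f₊ f^* = d`, injectivity of `f^*`, traces -/

section Degree

variable (hZ : IsSmoothProjective 2 Z) (hX : IsSmoothProjective 2 X) (f : Z ⟶ X)

/-- **Projection formula with `1`: `f₊ f^* y = y ∪ f₊ 1`** on `Hᵏ(X(ℂ); ℂ)`, `k ≤ 4` irrelevant
(`f₊ (f^* y ∪ 1) = y ∪ f₊ 1`, `f^* y ∪ 1 = f^* y`). [cite: FultonYoungTableaux1997, Appendix B §B.1 (6)] -/
theorem gysin_map_eq_cup_gysin_one {k : ℕ} (y : complexBetti X k) :
    complexGysin complexOrientationFamily hZ hX f (rfl : k + 2 * 2 = k + 2 * 2) (complexBetti.map f k y) =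
      cupProduct (Nat.add_zero k) y
        (complexGysin complexOrientationFamily hZ hX f (rfl : 0 + 2 * 2 = 0 + 2 * 2)
          (singularCohomology.one ℂ (Motives.ComplexPoints Z))) := by
  have h := complexGysin_cup hasPoincareDuality_complexOrientationFamily hZ hX f (Nat.add_zero k)
    (rfl : k + 2 * 2 = k + 2 * 2) (rfl : 0 + 2 * 2 = 0 + 2 * 2) (Nat.add_zero k) y
    (singularCohomology.one ℂ (Motives.ComplexPoints Z))
  rw [cupProduct_one] at h
  exact h

variable {hZ hX f}

/-- **`f₊ f^* y = d • y`** for `f` of cohomological degree `d` (`y ∪ (d • 1) = d • y`).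
[cite: FultonYoungTableaux1997, Appendix B §B.1 (6)] [cite: Fulton1998, Lemma 19.1.2] -/
theorem gysin_map_eq_smul {d : ℂ} (hdeg : Deg[hZ, hX, f, d]) {k : ℕ} (y : complexBetti X k) :
    complexGysin complexOrientationFamily hZ hX f (rfl : k + 2 * 2 = k + 2 * 2) (complexBetti.map f k y) =
      d • y := by
  rw [gysin_map_eq_cup_gysin_one hZ hX f y, hdeg, LinearMap.map_smul, cupProduct_one]

/-- **`f^*` is injective on `Hᵏ(X(ℂ); ℂ)`** when the cohomological degree is non-zero.
[cite: VoisinHodgeI2002, §7.3.2 Lemma 7.28] -/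
theorem map_injective_of_deg {d : ℂ} (hdeg : Deg[hZ, hX, f, d]) (hd : d ≠ 0) (k : ℕ) :
    Function.Injective (complexBetti.map f k) := by
  intro y y' h
  have h' := congrArg (complexGysin complexOrientationFamily hZ hX f (rfl : k + 2 * 2 = k + 2 * 2)) h
  simp only [gysin_map_eq_smul hdeg] at h'
  exact smul_right_injective _ hd h'

/-- **`∫_Z f^* w = d · ∫_X w`** on `H⁴` (`∫_X (f₊ 1 ∪ w) = ∫_Z (1 ∪ f^* w)`).
[cite: FultonYoungTableaux1997, Appendix B §B.1 (5)–(6)] -/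
theorem traceC_map_eq {d : ℂ} (hdeg : Deg[hZ, hX, f, d]) (w : complexBetti X (2 * 2)) :
    traceC hZ (complexBetti.map f (2 * 2) w) = d * traceC hX w := by
  have h := traceC_cup_complexGysin hZ hX f (rfl : 0 + 2 * 2 = 0 + 2 * 2) (Nat.zero_add (2 * 2))
    (Nat.zero_add (2 * 2)) (singularCohomology.one ℂ (Motives.ComplexPoints Z)) w
  rw [hdeg, LinearMap.map_smul₂, one_cupProduct, one_cupProduct, map_smul, smul_eq_mul] at h
  exact h.symm

/-- **`∫_Z (f^* a ∪ f^* b) = d · ∫_X (a ∪ b)`**: `f^*` scales the intersection form of `H²` by the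
cohomological degree. [cite: Inose1978, §2] [cite: FultonYoungTableaux1997, Appendix B §B.1 (3), (6)] -/
theorem traceC_cup_map_map {d : ℂ} (hdeg : Deg[hZ, hX, f, d]) (a b : complexBetti X (2 * 1)) :
    traceC hZ (cupProduct (rfl : 2 * 1 + 2 * 1 = 2 * 2) (complexBetti.map f (2 * 1) a)
        (complexBetti.map f (2 * 1) b)) =
      d * traceC hX (cupProduct (rfl : 2 * 1 + 2 * 1 = 2 * 2) a b) := by
  rw [← traceC_map_eq hdeg, cupProduct_map]

variable (hZ hX f) in
/-- **`∫_X (α ∪ f₊ w) = ∫_Z (f^* α ∪ w)`** (`α ∈ H²(X)`, `w ∈ H²(Z)`; the trace transposes the Gysin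
morphism into the pull-back). [cite: FultonYoungTableaux1997, Appendix B §B.1 (5)–(6)] -/
theorem traceC_cup_gysin (α : complexBetti X (2 * 1)) (w : complexBetti Z (2 * 1)) :
    traceC hX (cupProduct (rfl : 2 * 1 + 2 * 1 = 2 * 2) α
        (complexGysin complexOrientationFamily hZ hX f (rfl : 2 * 1 + 2 * 2 = 2 * 1 + 2 * 2) w)) =
      traceC hZ (cupProduct (rfl : 2 * 1 + 2 * 1 = 2 * 2) (complexBetti.map f (2 * 1) α) w) := by
  rw [cupProduct_two_two_comm, traceC_cup_complexGysin hZ hX f (rfl : 2 * 1 + 2 * 2 = 2 * 1 + 2 * 2)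
    (rfl : 2 * 1 + 2 * 1 = 2 * 2) (rfl : 2 * 1 + 2 * 1 = 2 * 2) w α, cupProduct_two_two_comm]

variable (hZ hX f) in
/-- **`∫_X (f₊ w ∪ α) = ∫_Z (w ∪ f^* α)`**. [cite: FultonYoungTableaux1997, Appendix B §B.1 (5)–(6)] -/
theorem traceC_gysin_cup (w : complexBetti Z (2 * 1)) (α : complexBetti X (2 * 1)) :
    traceC hX (cupProduct (rfl : 2 * 1 + 2 * 1 = 2 * 2)
        (complexGysin complexOrientationFamily hZ hX f (rfl : 2 * 1 + 2 * 2 = 2 * 1 + 2 * 2) w) α) =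
      traceC hZ (cupProduct (rfl : 2 * 1 + 2 * 1 = 2 * 2) w (complexBetti.map f (2 * 1) α)) :=
  traceC_cup_complexGysin hZ hX f (rfl : 2 * 1 + 2 * 2 = 2 * 1 + 2 * 2)
    (rfl : 2 * 1 + 2 * 1 = 2 * 2) (rfl : 2 * 1 + 2 * 1 = 2 * 2) w α

end Degree

/-! ### §2 Transcendental subspaces: `f^* T(X) ⊆ T(Z)`, `f₊ T(Z) ⊆ T(X)`, onto, multiplier -/

section Transcendental

/-- **`f^* T(X) ⊆ T(Z)`** (no degree hypothesis): for `y ⊥ N¹(X)` and `e ∈ N¹(Z)`,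
`∫_Z (f^* y ∪ e) = ∫_X (y ∪ f₊ e) = 0` because `f₊ e ∈ N¹(X)` (Gysin maps preserve algebraic classes).
[cite: Morrison1987Isogenies, §1 p. 180] [cite: VoisinHodgeII2003, §9.2.4 Prop. 9.21 (ii)] -/
theorem map_mem_transcendentalSubspace (hZ : IsSmoothProjective 2 Z) (hX : IsSmoothProjective 2 X) (f : Z ⟶ X)
    {y : complexBetti X (2 * 1)} (hy : y ∈ transcendentalSubspace X) :
    complexBetti.map f (2 * 1) y ∈ transcendentalSubspace Z := by
  rw [mem_transcendentalSubspace_iff_forall_algebraicClasses hZ]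
  intro e he
  apply eq_zero_of_traceC_eq_zero hZ
  have halg : complexGysin complexOrientationFamily hZ hX f (rfl : 2 * 1 + 2 * 2 = 2 * 1 + 2 * 2) e ∈
      algebraicClasses X 1 :=
    complexGysin_mem_algebraicClasses_of_mem_algebraicClasses complexOrientationFamily hZ hX f _ he
  rw [← traceC_cup_gysin hZ hX f y e,
    (mem_transcendentalSubspace_iff_forall_algebraicClasses hX y).1 hy _ halg, map_zero]

/-- **`f₊ T(Z) ⊆ T(X)`** (no degree hypothesis): for `w ⊥ N¹(Z)` and `c ∈ N¹(X)`,
`∫_X (f₊ w ∪ c) = ∫_Z (w ∪ f^* c) = 0` because `f^* c ∈ N¹(Z)` (pull-backs preserve algebraic classes,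
the tree's theorem `fulton1998_map_mem_algebraicClasses_holds'`).
[cite: Morrison1987Isogenies, §1 p. 180] [cite: Fulton1998, Cor. 19.2 (b)] -/
theorem gysin_mem_transcendentalSubspace (hZ : IsSmoothProjective 2 Z) (hX : IsSmoothProjective 2 X) (f : Z ⟶ X)
    {w : complexBetti Z (2 * 1)} (hw : w ∈ transcendentalSubspace Z) :
    complexGysin complexOrientationFamily hZ hX f (rfl : 2 * 1 + 2 * 2 = 2 * 1 + 2 * 2) w ∈
      transcendentalSubspace X := by
  rw [mem_transcendentalSubspace_iff_forall_algebraicClasses hX]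
  intro c hc
  apply eq_zero_of_traceC_eq_zero hX
  have halg : complexBetti.map f (2 * 1) c ∈ algebraicClasses Z 1 :=
    fulton1998_map_mem_algebraicClasses_holds' f hX hZ 1 c hc
  rw [traceC_gysin_cup hZ hX f w c,
    (mem_transcendentalSubspace_iff_forall_algebraicClasses hZ w).1 hw _ halg, map_zero]

variable {hZ : IsSmoothProjective 2 Z} {hX : IsSmoothProjective 2 X} {f : Z ⟶ X}

/-- **`f₊` maps `T(Z)` ONTO `T(X)`** when the cohomological degree `d` is non-zero:
`z = f₊ (d⁻¹ • f^* z)` with `f^* z ∈ T(Z)`. [cite: Inose1978, §2] -/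
theorem gysin_surjOn_transcendentalSubspace {d : ℂ} (hdeg : Deg[hZ, hX, f, d]) (hd : d ≠ 0)
    {z : complexBetti X (2 * 1)} (hz : z ∈ transcendentalSubspace X) :
    ∃ w ∈ transcendentalSubspace Z,
      complexGysin complexOrientationFamily hZ hX f (rfl : 2 * 1 + 2 * 2 = 2 * 1 + 2 * 2) w = z := by
  refine ⟨d⁻¹ • complexBetti.map f (2 * 1) z,
    Submodule.smul_mem _ _ (map_mem_transcendentalSubspace hZ hX f hz), ?_⟩
  rw [LinearMap.map_smul, gysin_map_eq_smul hdeg, smul_smul, inv_mul_cancel₀ hd, one_smul]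

/-- **The multiplier of `f₊` on `T(Z)`**: if `T(Z) ⊆ f^* H²(X)` on the classes in question (the
irreducibility input `w = f^* α`), then `∫_X (f₊ w ∪ f₊ w') = d · ∫_Z (w ∪ w')`
(`f₊ f^* α = d α` and `∫_X (α ∪ f₊ w') = ∫_Z (f^* α ∪ w')`). [cite: Inose1978, §2]
[cite: Morrison1987Isogenies, §1 Definition (strict isogeny)] -/
theorem traceC_cup_gysin_gysin_of_eq_map {d : ℂ} (hdeg : Deg[hZ, hX, f, d])
    {w w' : complexBetti Z (2 * 1)} {α : complexBetti X (2 * 1)} (hw : w = complexBetti.map f (2 * 1) α) :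
    traceC hX (cupProduct (rfl : 2 * 1 + 2 * 1 = 2 * 2)
        (complexGysin complexOrientationFamily hZ hX f (rfl : 2 * 1 + 2 * 2 = 2 * 1 + 2 * 2) w)
        (complexGysin complexOrientationFamily hZ hX f (rfl : 2 * 1 + 2 * 2 = 2 * 1 + 2 * 2) w')) =
      d * traceC hZ (cupProduct (rfl : 2 * 1 + 2 * 1 = 2 * 2) w w') := by
  rw [hw, gysin_map_eq_smul hdeg, LinearMap.map_smul₂, map_smul, smul_eq_mul, traceC_cup_gysin hZ hX f]

/-- **Multiplier, submodule form**: if `T(Z) ≤ (T(X)).map f^*` then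
`∫_X (f₊ w ∪ f₊ w') = d · ∫_Z (w ∪ w')` for all `w, w' ∈ T(Z)`. [cite: Inose1978, §2] -/
theorem traceC_cup_gysin_gysin_of_le {d : ℂ} (hdeg : Deg[hZ, hX, f, d])
    (hle : transcendentalSubspace Z ≤ (transcendentalSubspace X).map (complexBetti.map f (2 * 1)).hom)
    {w w' : complexBetti Z (2 * 1)} (hw : w ∈ transcendentalSubspace Z) :
    traceC hX (cupProduct (rfl : 2 * 1 + 2 * 1 = 2 * 2)
        (complexGysin complexOrientationFamily hZ hX f (rfl : 2 * 1 + 2 * 2 = 2 * 1 + 2 * 2) w)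
        (complexGysin complexOrientationFamily hZ hX f (rfl : 2 * 1 + 2 * 2 = 2 * 1 + 2 * 2) w')) =
      d * traceC hZ (cupProduct (rfl : 2 * 1 + 2 * 1 = 2 * 2) w w') := by
  obtain ⟨α, -, hα⟩ := Submodule.mem_map.1 (hle hw)
  exact traceC_cup_gysin_gysin_of_eq_map hdeg hα.symm

/-- **`f^* T(X) = T(Z)` from the inclusion `T(Z) ≤ f^* T(X)`** (the other inclusion is
`map_mem_transcendentalSubspace`). [cite: Inose1978, §2] [cite: Huybrechts2016K3, Ch. 3 Lemma 3.1] -/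
theorem transcendentalSubspace_eq_map_of_le (hZ : IsSmoothProjective 2 Z) (hX : IsSmoothProjective 2 X)
    (f : Z ⟶ X)
    (hle : transcendentalSubspace Z ≤ (transcendentalSubspace X).map (complexBetti.map f (2 * 1)).hom) :
    transcendentalSubspace Z = (transcendentalSubspace X).map (complexBetti.map f (2 * 1)).hom := by
  refine le_antisymm hle ?_
  rintro _ ⟨y, hy, rfl⟩
  exact map_mem_transcendentalSubspace hZ hX f hy

end Transcendental

/-! ### §3 The two-factor push–pull: `[(f, π)₊ 1]_* = f₊ ∘ π^*` -/

section PushPull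

variable (hZ : IsSmoothProjective 2 Z) (hX : IsSmoothProjective 2 X) (hY : IsSmoothProjective 2 Y)
  (f : Z ⟶ X) (π : Z ⟶ Y)

include hZ hX hY f π in

/-- **Push–pull for the graph class of a roof** (Fulton §16.1: the correspondence `(f, π)_*[Z]` from
`Y` to `X` acts by `f_* π^*`): for smooth projective surfaces and `f : Z ⟶ X`, `π : Z ⟶ Y`, the Gysin
image `γ = (f, π)₊ 1 ∈ H⁴((X ⊗ Y)(ℂ); ℂ)` of `1 ∈ H⁰(Z(ℂ); ℂ)` under `lift f π : Z ⟶ X ⊗ Y` acts on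
`H²(Y(ℂ); ℂ)` by `pr₁₊(pr₂^* y ∪ γ) = f₊ (π^* y)` — projection formula for `lift f π` read right to
left, `∪ 1 = id`, `lift f π ≫ pr₂ = π`, functoriality and `lift f π ≫ pr₁ = f` (the two-factor form of
the tree's `corrAction_gysinGraph_one`). [cite: Fulton1998, §16.1 Prop. 16.1.1 and Def. 16.1.2] -/
theorem corr_gysinLift_one (y : complexBetti Y (2 * 1)) :
    Corr[X, Y, hX, hY ;
      complexGysin complexOrientationFamily hZ (IsSmoothProjective.tensor_holds hX hY) (lift f π)
        (show 0 + 2 * (2 + 2) = 2 * 2 + 2 * 2 by omega)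
        (singularCohomology.one ℂ (Motives.ComplexPoints Z)), y] =
      complexGysin complexOrientationFamily hZ hX f (rfl : 2 * 1 + 2 * 2 = 2 * 1 + 2 * 2)
        (complexBetti.map π (2 * 1) y) := by
  have hμ := hasPoincareDuality_complexOrientationFamily
  have hXY := IsSmoothProjective.tensor_holds hX hY
  rw [← complexGysin_cup hμ hZ hXY (lift f π) (Nat.add_zero (2 * 1))
      (show 2 * 1 + 2 * (2 + 2) = 2 * 1 + 2 * 2 + 2 * 2 by omega)
      (show 0 + 2 * (2 + 2) = 2 * 2 + 2 * 2 by omega) rfl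
      (complexBetti.map (SemiCartesianMonoidalCategory.snd X Y) (2 * 1) y)
      (singularCohomology.one ℂ (Motives.ComplexPoints Z)),
    cupProduct_one, ← CategoryTheory.comp_apply, ← complexBetti.map_comp, lift_snd,
    ← LinearMap.comp_apply (f := complexGysin complexOrientationFamily hXY hX (fst X Y) _),
    ← complexGysin_comp hμ hZ hXY hX (lift f π) (fst X Y)]
  simp only [lift_fst]

/-- **`(f, π)₊ 1 ∈ algebraicClasses (X ⊗ Y) 2`**: the graph class of the roof is algebraic (proper
push-forward shifts the coniveau by the relative dimension; `1 ∈ N⁰H⁰`).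
[cite: FultonYoungTableaux1997, Appendix B §B.2 Exercise 5 and §B.3] -/
theorem gysinLift_one_mem_algebraicClasses :
    complexGysin complexOrientationFamily hZ (IsSmoothProjective.tensor_holds hX hY) (lift f π)
        (show 0 + 2 * (2 + 2) = 2 * 2 + 2 * 2 by omega)
        (singularCohomology.one ℂ (Motives.ComplexPoints Z)) ∈ algebraicClasses (X ⊗ Y) 2 :=
  complexGysin_mem_supportedClasses (gysinMap_restrictCompl_eq_zero_of_field ℂ) complexOrientationFamily
    hasPoincareDuality_complexOrientationFamily hZ (IsSmoothProjective.tensor_holds hX hY) (lift f π) _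
    (r := 0) (by omega) (by rw [supportedClasses_zero]; exact Submodule.mem_top)

/-- **`f₊ π^*` maps rational classes to rational classes** (`π^*` does, and the Gysin morphisms of the
complex orientation family do). [cite: VoisinHodgeI2002, §7.3.2] -/
theorem isRationalClass_gysin_map {y : complexBetti Y (2 * 1)} (hy : IsRationalClass y) :
    IsRationalClass (complexGysin complexOrientationFamily hZ hX f (rfl : 2 * 1 + 2 * 2 = 2 * 1 + 2 * 2)
      (complexBetti.map π (2 * 1) y)) :=
  isRationalClass_complexGysin_complexOrientationFamily hZ hX f _ (hy.map _)

/-- **`f₊ π^*` preserves the Hodge types of `H²`** (`π^*` is a morphism of Hodge structures; `f₊`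
between surfaces has bidegree `(0, 0)`). [cite: VoisinHodgeI2002, §7.3.2 (with Lemma 7.30)] -/
theorem isOfHodgeType_gysin_map (hY : IsSmoothProjective 2 Y) {i j : ℕ} {y : complexBetti Y (2 * 1)}
    (hy : IsOfHodgeType 2 Y (2 * 1) i j y) :
    IsOfHodgeType 2 X (2 * 1) i j
      (complexGysin complexOrientationFamily hZ hX f (rfl : 2 * 1 + 2 * 2 = 2 * 1 + 2 * 2)
        (complexBetti.map π (2 * 1) y)) := by
  have h := isOfHodgeType_complexGysin_of_add_eq_dim hZ hX f (s := 0) (Nat.add_zero 2)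
    (rfl : 2 * 1 + 2 * 2 = 2 * 1 + 2 * 2) (p := i) (q := j) (hy.map_of_isSmoothProjective hZ hY π)
  simpa using h

end PushPull

end Summit.HodgeConjecture.HodgeConjecture.Theorems.MarkmanPartnerTransport.FiniteMorphism

end
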